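import Mathlib
import Summits.Ventures.HodgeRepro.LitRank

/-!
# LitRankBound — `rank ≤ d + 1` for every CM triple (Kubota's "obviously", Yanai Prop. A (c), Dodson Thm 1.0 (ii))

Blind cell `pub-hodge-repro`, seat lit-2 (gen 3).  Companion of `LitRank.lean` (same seat), where the
bound is typed as the named fact `Yanai1985_propA_c_upper` (Yanai 1985 Prop. A (c), second
inequality, p.170: "rank(K,S) ≤ min(d + 1, d′ + 1)" — the `d + 1` half; Kubota 1965 p.115 "we have
obviously rank(F;{φ_i}) ≤ m + 1"; Dodson 1987 Thm 1.0 (ii) "t ∈ S(n) implies t ≤ n + 1") and proved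
there only in the Galois case `H = 1` (`rank_le_dim_add_one_of_H_eq_bot`).

The printed reason ("obviously"): the Galois translate `g τ` of Kubota's element `τ = Σ_{σ∈S̃} σ`
depends only on the left coset `gH` (`S̃` is a union of right cosets `H g`, so `h τ = τ` for
`h ∈ H`), and `g τ + (ρ g) τ = N` (the norm element), so the `[G:H] = 2d` translates are spanned
by one translate per pair `{gH, ρ g H}` together with `N`: `d + 1` elements.  The pairs are the
orbits of the fixed-point-free involution `q ↦ ρ • q` of `G/H`; we pick the smaller element of
each pair for an auxiliary linear order (`LinearOrder.lift'` along `Fintype.equivFin`).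

Main results
* `CMTriple.single_mul_tau_of_mem_H` : `h τ = τ` for `h ∈ H`;
* `CMTriple.rank_le_dim_add_one` : `T.rank ≤ T.dim + 1` for EVERY triple (no simplicity needed);
* `Yanai1985_propA_c_upper_holds : Yanai1985_propA_c_upper` — the named fact is discharged.

No new named fact is introduced (D-0026).
-/

open Finset
open scoped Pointwise

namespace HodgeRepro.Lit2

namespace CMTriple

variable {G : Type*} [Group G] [Fintype G] [DecidableEq G] (T : CMTriple G)

omit [Fintype G] in
/-- `h S̃ = S̃` for `h ∈ H` (`S̃` is a union of right cosets `H g`). -/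
theorem smul_S_of_mem_H {h : G} (hh : h ∈ T.H) : h • T.S = T.S := by
  apply Finset.eq_of_subset_of_card_le
  · intro x hx
    rw [Finset.mem_smul_finset] at hx
    obtain ⟨y, hy, rfl⟩ := hx
    exact T.H_mul_mem h hh y hy
  · rw [Finset.card_smul_finset]

omit [Fintype G] in
/-- `h τ = τ` for `h ∈ H`. -/
theorem single_mul_tau_of_mem_H {h : G} (hh : h ∈ T.H) :
    MonoidAlgebra.single h (1 : ℚ) * T.tau = T.tau := by
  rw [T.single_mul_tau, T.smul_S_of_mem_H hh]
  rfl

omit [Fintype G] in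
/-- `(g h) τ = g τ` for `h ∈ H`: the translate depends only on the left coset `gH`. -/
theorem single_mul_tau_mul_mem_H (g : G) {h : G} (hh : h ∈ T.H) :
    MonoidAlgebra.single (g * h) (1 : ℚ) * T.tau = MonoidAlgebra.single g (1 : ℚ) * T.tau := by
  have : MonoidAlgebra.single (g * h) (1 : ℚ) =
      MonoidAlgebra.single g (1 : ℚ) * MonoidAlgebra.single h (1 : ℚ) := by
    rw [MonoidAlgebra.single_mul_single, mul_one]
  rw [this, mul_assoc, T.single_mul_tau_of_mem_H hh]

omit [Fintype G] in
/-- Equal left cosets give equal translates. -/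
theorem single_mul_tau_eq_of_mk_eq {g g' : G} (h : (g : G ⧸ T.H) = g') :
    MonoidAlgebra.single g (1 : ℚ) * T.tau = MonoidAlgebra.single g' (1 : ℚ) * T.tau := by
  rw [QuotientGroup.eq] at h
  have : g' = g * (g⁻¹ * g') := by group
  rw [this, T.single_mul_tau_mul_mem_H g h]

/-- **`rank ≤ d + 1` for every CM triple** (Kubota 1965 p.115 "obviously"; Yanai 1985 Prop. A (c);
Dodson 1987 Thm 1.0 (ii)): one translate per pair `{gH, ρgH}` of left cosets plus the norm element
span all translates. -/
theorem rank_le_dim_add_one : T.rank ≤ T.dim + 1 := by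
  classical
  -- the quotient `G/H`, its involution `σ q = ρ • q`, and an auxiliary linear order
  let Q := G ⧸ T.H
  let σ : Q → Q := fun q => T.ρ • q
  have hσσ : ∀ q, σ (σ q) = q := fun q => by
    simp only [σ, smul_smul, T.ρ_mul_self, one_smul]
  have hσne : ∀ q, σ q ≠ q := by
    intro q
    induction q using QuotientGroup.induction_on with
    | H a =>
      intro h
      have h' : ((T.ρ * a : G) : Q) = (a : Q) := h
      rw [QuotientGroup.eq] at h'
      apply T.ρ_notMem_H
      have hinv : T.ρ⁻¹ = T.ρ := by rw [inv_eq_iff_mul_eq_one, T.ρ_mul_self]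
      have : (T.ρ * a)⁻¹ * a = T.ρ := by
        rw [mul_inv_rev, mul_assoc, hinv, T.ρ_comm a, inv_mul_cancel_left]
      rwa [this] at h'
  letI : LinearOrder Q := LinearOrder.lift' (Fintype.equivFin Q) (Fintype.equivFin Q).injective
  let A : Finset Q := univ.filter fun q => q < σ q
  let B : Finset Q := univ.filter fun q => σ q < q
  have hσinj : Function.Injective σ := Function.LeftInverse.injective hσσ
  have hAB : A.image σ = B := by
    ext q
    simp only [A, B, Finset.mem_image, Finset.mem_filter, Finset.mem_univ, true_and]
    constructor
    · rintro ⟨p, hp, rfl⟩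
      rwa [hσσ]
    · intro hq
      exact ⟨σ q, by rwa [hσσ], hσσ q⟩
  have hcardAB : A.card = B.card := by
    rw [← hAB, Finset.card_image_of_injective _ hσinj]
  have hunion : A ∪ B = univ := by
    ext q
    simp only [A, B, Finset.mem_union, Finset.mem_filter, Finset.mem_univ, true_and, iff_true]
    rcases lt_or_gt_of_ne (hσne q) with h | h
    · exact Or.inr h
    · exact Or.inl h
  have hdisj : Disjoint A B := by
    rw [Finset.disjoint_left]
    intro q hqA hqB
    simp only [A, B, Finset.mem_filter, Finset.mem_univ, true_and] at hqA hqB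
    exact lt_asymm hqA hqB
  have hcardQ : 2 * A.card = Fintype.card Q := by
    rw [← Finset.card_univ, ← hunion, Finset.card_union_of_disjoint hdisj, hcardAB]
    ring
  have hdim : T.dim = A.card := by
    unfold dim
    rw [Subgroup.index_eq_card, Nat.card_eq_fintype_card, ← hcardQ]
    omega
  -- the generating finset: one translate per element of `A`, plus `N`
  let f : G → MonoidAlgebra ℚ G := fun g => MonoidAlgebra.single g (1 : ℚ) * T.tau
  let F : Finset (MonoidAlgebra ℚ G) := insert normElt (A.image fun q => f q.out)
  have hmem : ∀ q ∈ A, f q.out ∈ Submodule.span ℚ (F : Set (MonoidAlgebra ℚ G)) := by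
    intro q hq
    apply Submodule.subset_span
    simp only [F, coe_insert, coe_image, Set.mem_insert_iff, Set.mem_image, mem_coe]
    exact Or.inr ⟨q, hq, rfl⟩
  have hN : normElt ∈ Submodule.span ℚ (F : Set (MonoidAlgebra ℚ G)) := by
    apply Submodule.subset_span
    simp [F]
  have hle : Submodule.span ℚ (Set.range f) ≤ Submodule.span ℚ (F : Set (MonoidAlgebra ℚ G)) := by
    rw [Submodule.span_le]
    rintro _ ⟨g, rfl⟩
    simp only [SetLike.mem_coe]
    rcases lt_or_gt_of_ne (hσne (g : Q)) with h | h
    · -- `ρ g H` is the smaller element: `g τ = N − (g ρ) τ`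
      have hA : σ (g : Q) ∈ A := by
        simp only [A, Finset.mem_filter, Finset.mem_univ, true_and]
        rwa [hσσ]
      have hmk : ((g * T.ρ : G) : Q) = σ (g : Q) := by
        show ((g * T.ρ : G) : Q) = ((T.ρ * g : G) : Q)
        rw [T.ρ_comm]
      have hf : MonoidAlgebra.single (g * T.ρ) (1 : ℚ) * T.tau = f ((σ (g : Q)).out) :=
        T.single_mul_tau_eq_of_mk_eq (by rw [QuotientGroup.out_eq', hmk])
      show MonoidAlgebra.single g (1 : ℚ) * T.tau ∈ _
      rw [T.single_mul_tau_eq_normElt_sub g, hf]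
      exact Submodule.sub_mem _ hN (hmem _ hA)
    · -- `gH` is the smaller element of its pair
      have hA : (g : Q) ∈ A := by
        simp only [A, Finset.mem_filter, Finset.mem_univ, true_and]
        exact h
      have hf : f g = f ((g : Q).out) :=
        T.single_mul_tau_eq_of_mk_eq (by rw [QuotientGroup.out_eq'])
      rw [hf]
      exact hmem _ hA
  calc T.rank = Module.finrank ℚ (Submodule.span ℚ (Set.range f)) := by
        unfold rank; rw [T.range_mulRight_tau]
    _ ≤ Module.finrank ℚ (Submodule.span ℚ (F : Set (MonoidAlgebra ℚ G))) :=
        Submodule.finrank_mono hle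
    _ ≤ F.card := finrank_span_finset_le_card F
    _ ≤ A.card + 1 := (card_insert_le _ _).trans (by
        have := card_image_le (s := A) (f := fun q : Q => f q.out)
        omega)
    _ = T.dim + 1 := by rw [hdim]

end CMTriple

/-- **Yanai 1985 Prop. A (c), upper bound, holds** (for every triple; the simplicity hypothesis of
the printed statement is not needed). [cite: Yanai1985, Prop. A(c); Kubota1965, p.115; Dodson1987,
Thm 1.0(ii)] -/
theorem Yanai1985_propA_c_upper_holds : Yanai1985_propA_c_upper :=
  fun _ _ _ _ T _ => T.rank_le_dim_add_one

end HodgeRepro.Lit2
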